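import Summits.CriticalPhenomena.PercolationContinuityZ3.Theorems.PercNearOneGluingNoHeavyLowerTailSahiCombTriWShell

/-!
# The SHARP FORM (♠♠) of `TRI_W(2)`: typed conjecture and the reduction `(♠♠) ⟹ TRI_W(2) ≥ 0`

Support file of the one-cut programme (crux `NoHeavyLowerTail`, stmt-CriticalPhenomena-4575; cell `prim-masterthm`, seat P5 gen 12;
report `P5-LORENTZIAN-TEST.md` §17.5–17.8, memo `FROM-prim-masterthm-p5-g12-SHARP-FORM.md`).

At `a = 2` the index cube is `{∅, {a}, {b}, univ}` and a pair of monotone families is an 8-tuple of up-sets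
`F₀ ⊆ Fp, Fq ⊆ F₁`, `G₀ ⊆ Gp, Gq ⊆ G₁` (outer nested pair `(F₀,F₁;G₀,G₁)`, inner — in general NON-nested — pair `(Fp,Fq;Gp,Gq)`).
By the pair decomposition (`FiveUpSet.two_mul_triW`) `TRI_W(2) = triWOne(F₀,F₁,G₀,G₁) + triWOne(Fp,Fq,Gp,Gq)`, and by `LatticeFiveUpSet.triWOne_eq`
the outer term is `FUS + #(P ∩ Sh) + Kl_P(G₀;F₁) + Kl_P(F₀;G₁)` with `FUS` the five-up-set slack (`≥ 0`, `fiveUpSetIneq_holds`), `Sh = (F₁ \ F₀) ∩ (G₁ \ G₀)`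
and two Kleitman gaps.  The census of report §17.6 says the two gaps are NEVER needed:

* `FiveUpSet.sharpTwo P F₀ Fp Fq F₁ G₀ Gp Gq G₁ := FUS + #(P ∩ Sh) + triWOne compl P Fp Fq Gp Gq` and the typed conjecture **`FiveUpSet.SharpTwoIneq`**
  (`@[conjecture]`, an obligation of our theory, never a fact): `0 ≤ sharpTwo …` for all up-sets with the four nestings.  CENSUS (exact C, code12/s2/sharpc.c):
  general `W = 2^n` EXHAUSTIVE `(n,a) = (2,2)` (169,344 `(P,F,G)`) and `(3,2)` (1,149,431,220), cylinders `(2,2,2)` exhaustive (4,741,632), cylinders `(2,3,2)`, `(2,2,3)`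
  (9.7e8 each, 10 % samples), `(4,2)` 5.0e8, `(5,2)` 1.14e9 sampled: 0 violations, minimum slack 0; sharp (no further Kleitman gap and no part of the factor 2 on the shell can be
  removed, exhaustive `n ≤ 3`); indecomposable as a Hall statement; its generic 9×9 zeta-kernel rank certificate is full rank on all 57.5 M instances with `n ≤ 3`.
  In Hall form: `{F₁∩refl G₀, refl F₀∩G₁, refl Sh} ⊎ {Fp∩refl Gq, refl Fp∩Gq, refl(Fp∩Gp), Fq∩refl Gp, refl Fq∩Gp, refl(Fq∩Gq)} ≼ {F₁∩G₁, F₀∩G₀, Sh, (Fp∩Gp)², (Fq∩Gq)², refl(Fp∩Gq), refl(Fq∩Gp)}` —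
  RANK-Z's block plus the inner pair plus ONE shell supply.
* `FiveUpSet.triWOne_add_triWOne_eq` — the identity `triWOne(outer) + triWOne(inner) = sharpTwo + Kl_P(G₀;F₁) + Kl_P(F₀;G₁)`;
* **`FiveUpSet.pair_nonneg_of_sharpTwoIneq`** — `SharpTwoIneq ⟹ 0 ≤ triWOne compl P F₀ F₁ G₀ G₁ + triWOne compl P Fp Fq Gp Gq` (two Kleitman gaps);
* **`FiveUpSet.triW_nonneg_of_sharpTwoIneq`** — `SharpTwoIneq ⟹ 0 ≤ triW P F G` for every index type `β` with `Fintype.card β = 2`, i.e. `(♠♠) ⟹ TRI_W(2) ≥ 0`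
  (`⟹` (M⁺⁺-3) on every cell `(2,b,c)` via `hybCoeff_eq_tri`).
HONEST LABEL: a typed conjecture (census-clean, NOT proved) and an unconditional reduction; `TriWIneq` and `SharpTwoIneq` are OPEN. [this work]
-/

namespace Summit.CriticalPhenomena.PercolationContinuityZ3.Theorems

namespace FiveUpSet

open Finset

variable {γ : Type} [DecidableEq γ] [Fintype γ]

/-- The sharp-form slack at `a = 2`: five-up-set slack of the outer pair + one copy of the outer shell inside `P` + the thin-edge functional of the
inner (non-nested) pair: `sharpTwo = [#(P∩F₁∩G₁) + #(P∩F₀∩G₀) − #(P∩F₁∩refl G₀) − #(P∩refl F₀∩G₁) − #(P∩refl(F₁\F₀)∩refl(G₁\G₀))] + #(P∩(F₁\F₀)∩(G₁\G₀))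
+ triWOne compl P Fp Fq Gp Gq`. [this work] -/
def sharpTwo (P F₀ Fp Fq F₁ G₀ Gp Gq G₁ : Finset (Finset γ)) : ℤ :=
  ((((P ∩ F₁ ∩ G₁).card : ℤ) + (P ∩ F₀ ∩ G₀).card - (P ∩ F₁ ∩ refl G₀).card - (P ∩ refl F₀ ∩ G₁).card
      - (P ∩ refl (F₁ \ F₀) ∩ refl (G₁ \ G₀)).card)
    + (P ∩ (F₁ \ F₀) ∩ (G₁ \ G₀)).card)
  + LatticeFiveUpSet.triWOne (complEquiv γ) P Fp Fq Gp Gq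

/-- **(♠♠) — the SHARP FORM of `TRI_W(2)`** (CONJECTURE, census-clean; an obligation of our theory, never a fact): for every finite cube and all up-sets
`P`, `F₀ ⊆ Fp, Fq ⊆ F₁`, `G₀ ⊆ Gp, Gq ⊆ G₁`: `0 ≤ sharpTwo P F₀ Fp Fq F₁ G₀ Gp Gq G₁`.  Equivalently `TRI_W(2) ≥ Kl_P(F₀;G₁) + Kl_P(G₀;F₁)`
(report §17.6; exhaustive general-`W` `(2,2)`, `(3,2)` and cylinders `(2,2,2)`, ≈ 4e9 further sampled instances, 0 violations). OPEN. [this work] -/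
@[conjecture] def SharpTwoIneq : Prop :=
  ∀ (γ : Type) [DecidableEq γ] [Fintype γ] (P F₀ Fp Fq F₁ G₀ Gp Gq G₁ : Finset (Finset γ)),
    IsUpperSet (P : Set (Finset γ)) →
    IsUpperSet (F₀ : Set (Finset γ)) → IsUpperSet (Fp : Set (Finset γ)) → IsUpperSet (Fq : Set (Finset γ)) → IsUpperSet (F₁ : Set (Finset γ)) →
    IsUpperSet (G₀ : Set (Finset γ)) → IsUpperSet (Gp : Set (Finset γ)) → IsUpperSet (Gq : Set (Finset γ)) → IsUpperSet (G₁ : Set (Finset γ)) →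
    F₀ ⊆ Fp → F₀ ⊆ Fq → Fp ⊆ F₁ → Fq ⊆ F₁ → G₀ ⊆ Gp → G₀ ⊆ Gq → Gp ⊆ G₁ → Gq ⊆ G₁ →
    0 ≤ sharpTwo P F₀ Fp Fq F₁ G₀ Gp Gq G₁

/-- **The pair sum in sharp form**: `triWOne(outer) + triWOne(inner) = sharpTwo + [#(P∩F₁∩G₀) − #(P∩refl F₁∩G₀)] + [#(P∩F₀∩G₁) − #(P∩F₀∩refl G₁)]`
(the two bottom-index Kleitman gaps), for a nested outer pair. [this work] -/
theorem triWOne_add_triWOne_eq (P F₀ Fp Fq F₁ G₀ Gp Gq G₁ : Finset (Finset γ)) (hF : F₀ ⊆ F₁) (hG : G₀ ⊆ G₁) :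
    LatticeFiveUpSet.triWOne (complEquiv γ) P F₀ F₁ G₀ G₁ + LatticeFiveUpSet.triWOne (complEquiv γ) P Fp Fq Gp Gq
      = sharpTwo P F₀ Fp Fq F₁ G₀ Gp Gq G₁
        + (((P ∩ F₁ ∩ G₀).card : ℤ) - (P ∩ refl F₁ ∩ G₀).card)
        + (((P ∩ F₀ ∩ G₁).card : ℤ) - (P ∩ F₀ ∩ refl G₁).card) := by
  rw [LatticeFiveUpSet.triWOne_eq (complEquiv γ) P F₀ F₁ G₀ G₁ hF hG]
  unfold sharpTwo
  simp only [image_complEquiv]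
  ring

/-- **`(♠♠) ⟹` the pair sum is non-negative**: for up-sets with the four nestings, `0 ≤ triWOne compl P F₀ F₁ G₀ G₁ + triWOne compl P Fp Fq Gp Gq`
(the two extra terms of `triWOne_add_triWOne_eq` are Kleitman gaps, `≥ 0` by `card_inter_refl_le` / `card_refl_inter_le`). [this work] -/
theorem pair_nonneg_of_sharpTwoIneq (h : SharpTwoIneq) (P F₀ Fp Fq F₁ G₀ Gp Gq G₁ : Finset (Finset γ))
    (hP : IsUpperSet (P : Set (Finset γ)))
    (hF₀ : IsUpperSet (F₀ : Set (Finset γ))) (hFp : IsUpperSet (Fp : Set (Finset γ))) (hFq : IsUpperSet (Fq : Set (Finset γ)))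
    (hF₁ : IsUpperSet (F₁ : Set (Finset γ))) (hG₀ : IsUpperSet (G₀ : Set (Finset γ))) (hGp : IsUpperSet (Gp : Set (Finset γ)))
    (hGq : IsUpperSet (Gq : Set (Finset γ))) (hG₁ : IsUpperSet (G₁ : Set (Finset γ)))
    (h0p : F₀ ⊆ Fp) (h0q : F₀ ⊆ Fq) (hp1 : Fp ⊆ F₁) (hq1 : Fq ⊆ F₁) (k0p : G₀ ⊆ Gp) (k0q : G₀ ⊆ Gq) (kp1 : Gp ⊆ G₁) (kq1 : Gq ⊆ G₁) :
    0 ≤ LatticeFiveUpSet.triWOne (complEquiv γ) P F₀ F₁ G₀ G₁ + LatticeFiveUpSet.triWOne (complEquiv γ) P Fp Fq Gp Gq := by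
  rw [triWOne_add_triWOne_eq P F₀ Fp Fq F₁ G₀ Gp Gq G₁ (h0p.trans hp1) (k0p.trans kp1)]
  have hs := h γ P F₀ Fp Fq F₁ G₀ Gp Gq G₁ hP hF₀ hFp hFq hF₁ hG₀ hGp hGq hG₁ h0p h0q hp1 hq1 k0p k0q kp1 kq1
  -- Kleitman inside the up-sets `P ∩ G₀` and `P ∩ F₀`
  have hPG₀ : IsUpperSet ((P ∩ G₀ : Finset (Finset γ)) : Set (Finset γ)) := by rw [coe_inter]; exact hP.inter hG₀
  have hPF₀ : IsUpperSet ((P ∩ F₀ : Finset (Finset γ)) : Set (Finset γ)) := by rw [coe_inter]; exact hP.inter hF₀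
  have k1 := card_inter_refl_le hPG₀ hF₁
  have k2 := card_inter_refl_le hPF₀ hG₁
  have e1 : P ∩ G₀ ∩ refl F₁ = P ∩ refl F₁ ∩ G₀ := by rw [inter_assoc, inter_comm G₀, ← inter_assoc]
  have e2 : P ∩ G₀ ∩ F₁ = P ∩ F₁ ∩ G₀ := by rw [inter_assoc, inter_comm G₀, ← inter_assoc]
  rw [e1, e2] at k1
  omega

/-! ### From the pair sum to `triW` for an index cube of size two -/

/-- For `univ = {a, b}` with `a ≠ b`: `{a}ᶜ = {b}` in `Finset β`. [this work] -/
theorem compl_singleton_eq_of_univ {β : Type} [DecidableEq β] [Fintype β] {a b : β} (hab : a ≠ b)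
    (hu : (univ : Finset β) = {a, b}) : ({a} : Finset β)ᶜ = {b} := by
  ext x
  rw [mem_compl, mem_singleton, mem_singleton]
  have hx : x ∈ ({a, b} : Finset β) := hu ▸ mem_univ x
  rw [mem_insert, mem_singleton] at hx
  constructor
  · intro hxa
    rcases hx with h | h
    · exact absurd h hxa
    · exact h
  · rintro rfl
    exact fun h => hab h.symm

/-- **`(♠♠) ⟹ TRI_W(2) ≥ 0`**: if `SharpTwoIneq` holds then `0 ≤ triW P F G` for every up-set `P` and all monotone families `F, G` of up-sets over an
index cube `Finset β` with `Fintype.card β = 2` (pair decomposition `two_mul_triW` + `pair_nonneg_of_sharpTwoIneq` on the two antipodal index pairs). [this work] -/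
theorem triW_nonneg_of_sharpTwoIneq {β : Type} [DecidableEq β] [Fintype β] (h : SharpTwoIneq) (hβ : Fintype.card β = 2)
    (P : Finset (Finset γ)) (F G : Finset β → Finset (Finset γ))
    (hP : IsUpperSet (P : Set (Finset γ))) (hF : ∀ x, IsUpperSet (F x : Set (Finset γ)))
    (hG : ∀ x, IsUpperSet (G x : Set (Finset γ))) (hFm : Monotone F) (hGm : Monotone G) : 0 ≤ triW P F G := by
  -- the two atoms of the index cube
  have hcard : (univ : Finset β).card = 2 := by rw [card_univ, hβ]
  obtain ⟨a, b, hab, hu⟩ := card_eq_two.1 hcard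
  set f : Finset β → ℤ := fun x =>
    LatticeFiveUpSet.triWOne (complEquiv γ) P (F x) (F xᶜ) (G x) (G xᶜ) with hf
  have h2 : 2 * triW P F G = ∑ x : Finset β, f x := two_mul_triW P F G
  -- enumerate the index cube: `univ (Finset β) = powerset {a, b}`
  have hpb : ({b} : Finset β).powerset = {∅, {b}} := by
    ext t; rw [mem_powerset, subset_singleton_iff, mem_insert, mem_singleton]
  have hia : insert a (∅ : Finset β) = {a} := by ext x; simp
  have hsum : ∑ x : Finset β, f x = f ∅ + f {b} + (f {a} + f {a, b}) := by
    rw [← Finset.powerset_univ, hu, Finset.sum_powerset_insert (by rwa [mem_singleton]), hpb,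
      Finset.sum_pair (Finset.singleton_ne_empty b).symm, Finset.sum_pair (Finset.singleton_ne_empty b).symm, hia]
  -- complements inside the index cube
  have cab : ({a} : Finset β)ᶜ = {b} := compl_singleton_eq_of_univ hab hu
  have cba : ({b} : Finset β)ᶜ = {a} := by
    have hu' : (univ : Finset β) = {b, a} := by rw [hu, pair_comm]
    exact compl_singleton_eq_of_univ hab.symm hu'
  have cuniv : ({a, b} : Finset β) = univ := hu.symm
  -- symmetry of `triWOne` under swapping the two members of both pairs
  have hsym : ∀ A₀ A₁ B₀ B₁ : Finset (Finset γ),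
      LatticeFiveUpSet.triWOne (complEquiv γ) P A₁ A₀ B₁ B₀ = LatticeFiveUpSet.triWOne (complEquiv γ) P A₀ A₁ B₀ B₁ := by
    intro A₀ A₁ B₀ B₁; unfold LatticeFiveUpSet.triWOne; ring
  -- the four values of `f`
  have f0 : f ∅ = LatticeFiveUpSet.triWOne (complEquiv γ) P (F ∅) (F univ) (G ∅) (G univ) := by
    simp only [hf, compl_empty]
  have f1 : f {a, b} = LatticeFiveUpSet.triWOne (complEquiv γ) P (F ∅) (F univ) (G ∅) (G univ) := by
    simp only [hf, cuniv, compl_univ]; exact hsym _ _ _ _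
  have fa : f {a} = LatticeFiveUpSet.triWOne (complEquiv γ) P (F {a}) (F {b}) (G {a}) (G {b}) := by
    simp only [hf, cab]
  have fb : f {b} = LatticeFiveUpSet.triWOne (complEquiv γ) P (F {a}) (F {b}) (G {a}) (G {b}) := by
    simp only [hf, cba]; exact hsym _ _ _ _
  -- the pair sum `outer + inner` is non-negative by (♠♠)
  have hpair : 0 ≤ LatticeFiveUpSet.triWOne (complEquiv γ) P (F ∅) (F univ) (G ∅) (G univ)
      + LatticeFiveUpSet.triWOne (complEquiv γ) P (F {a}) (F {b}) (G {a}) (G {b}) :=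
    pair_nonneg_of_sharpTwoIneq h P (F ∅) (F {a}) (F {b}) (F univ) (G ∅) (G {a}) (G {b}) (G univ) hP
      (hF ∅) (hF {a}) (hF {b}) (hF univ) (hG ∅) (hG {a}) (hG {b}) (hG univ)
      (hFm (empty_subset _)) (hFm (empty_subset _)) (hFm (subset_univ _)) (hFm (subset_univ _))
      (hGm (empty_subset _)) (hGm (empty_subset _)) (hGm (subset_univ _)) (hGm (subset_univ _))
  have : 0 ≤ 2 * triW P F G := by
    rw [h2, hsum, f0, f1, fa, fb]
    linarith
  omega

end FiveUpSet

end Summit.CriticalPhenomena.PercolationContinuityZ3.Theorems
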